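import Summits.QuantumFields.BalabanUV.T4Continuum.Support.NE7FluxGradInteriorLetter
import Summits.QuantumFields.BalabanUV.T4Continuum.Support.NE7CovDivGeneralDatum
import Summits.QuantumFields.BalabanUV.T4Continuum.Support.AveragingDeficitFermat
import HarnessLib

/-!
# NE7FluxGradOfTanCritical — supplier stub (S-h) of the NE7 crux, part (c5) (ROAD-G108 §4): (10) TYPE UP TO A LOGARITHM FOR OUR TANGENT-CRITICAL CONFIGURATIONS, ANY DATUM —
# for a unitary `(N·L^{k+1})`-periodic `U` of the multi-level small-field class with `SmallField U a` (`a ≤ 1∕50`) and TANGENT-CRITICAL (the first variation vanishes on the tangent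
# space of the constraint), at EVERY bond and plane and for every scale `m ≥ 1`:
#   `‖∇_U F(x₀; j, π)‖ ≤ C(d)·[(1 + log m)·(248a² + 12τa + 2(T_c + 4dτa)) + 2a∕m] + 4τa`,  `τ = (d+1)·(d(3m+2))·a`,  `T_c = card n·(c_R·K_maj·(L∕L^d)^{k+1} + 12·#Plane·a²)`
# (at `d = 4`, `a = εη²`, `m ≍ M = η⁻¹`: `O((1 + log M)·ε·η³)` — [Balaban1985Variational] Thm 1 (10)'s shape up to the logarithm)

Cell `pub-balaban`, rung (B)+1 sub-cell t4, lineage `b2b-balaban-t4-ne7-p1`, generation 108 (CRUX PROVER NE7 #1 = OWNER of BINDER row NE7).  Memo `t4/b2b-balaban-t4-ne7-p1-g108/ROAD-G108.md` §4 (c).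
THE ARGUMENT.  The near-identity (axial) gauge `u` of `BlockAverageCurrent.exists_nearId_gauge` around `x₀` (`‖U^{u}(y,κ) − 1‖ ≤ (d+1)R·a` on the `ℓ¹`-ball of radius `R = d(3m+2)`,
which contains `cube x₀ (3m+2)`); `V = U^{u}` is unitary with the same plaquette radius (`smallField_gaugeAct`), its tension has the same norm as `U`'s (gen 72's
`NE7TensionGaugeLetter.norm_tension_gaugeAct`), `U`'s tension is `(N·L^{k+1})`-periodic and bounded on the period box by gen 91's `NE7CovDivGeneralDatum.norm_tension_le_of_tanCritical_gen`
(hence everywhere); THIS generation's `NE7FluxGradInteriorLetter.fluxGrad_interior_letter` at `V`; and `‖∇_U F‖ = ‖∇_V F_V‖` (`AveragingDeficitKDatum.norm_covGrad_flux_eq_of_gaugeAct`).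
WHAT ([folklore]; 0 def, 0 sorry; `d ≥ 3`).  `l1_sub_le_of_mem_cube`; **`fluxGrad_le_of_tanCritical`** (displayed above).
HONEST FRAMING (page 1): a LETTER about ONE configuration under displayed hypotheses (tangent-criticality, class regime); for minimisers over the small data tangent-criticality is
gen 90's `NE7OpenOfMinimisation.tanCritical_of_isMinimiser` + (8)∀ — the docking (c6) into `NE7Route1EndDockedSmallDataSU2Log` is the next file; NOT NE3∕NE7; spine 0∕9; finite T⁴
rung (B)+1 — NOT infinite volume, NOT mass gap, NOT BetaPertH, NOT Clay.
-/

set_option autoImplicit false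

open scoped BigOperators Matrix Matrix.Norms.L2Operator
open NormedSpace Finset

namespace Summit.QuantumFields.BalabanUV.T4Continuum.NE7FluxGradOfTanCritical

open Literature.MathematicalPhysics.QuantumFieldTheory.Balaban1983to89
open B7Prop1Explicit B7Prop2Explicit
open T4AveragingDeficitWall (IsUnitaryCfg IsSkewDir SmallField Ad covGrad flux fhol)
open T4AveragingDeficitWallBoundary (IsPeriodicCfg periodBox mem_periodBox)
open AveragingDeficitPeriodicCounting (IsPeriodicDir)
open AveragingDeficitTwoLevelPrep (twoLevelSmall)
open AveragingDeficitMultiLevelPrep (LevelSmall)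
open AveragingDeficitKDatum (isUnitaryCfg_gaugeAct norm_covGrad_flux_eq_of_gaugeAct)
open AveragingDeficitTorusChart (redN eq_wrap_add periodic_smul_vec)
open AveragingDeficitFermat (boxVec_redN_mem)
open BlockAverageCurrent (smallField_gaugeAct exists_nearId_gauge)
open BlockAverageVaryHolo (nbRad)
open GaugeFieldPerturbation (norm_fhol_sub_one_le_of_smallField)
open MinimalActionLevels (perWin)
open NE3TangentCovariantTower (dirIter)
open NE3HessForm (dAction)
open NE3CovariantCalculus (cDstar)
open NE3QbarIterCovLiftPrep (cruxC)
open NE3RightInverseSolveLetters (thetaLoc)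
open NE3HatInvCurlLetters (curl1C curl1C_nonneg)
open Beta.PoissonInterior (cube mem_cube cube_mono)
open NE7FluxGradientFromTension (exists_fluxForm fluxForm_periodic)
open NE7TensionGaugeLetter (norm_tension_gaugeAct)
open NE7CovDivGeneralDatum (norm_tension_le_of_tanCritical_gen)
open NE7FluxGradInteriorLetter (fluxGrad_interior_letter)

noncomputable section

variable {d : ℕ} {n : Type*} [Fintype n] [DecidableEq n]

/-! ## §1 The sup-norm cube sits in an `ℓ¹`-ball -/

omit [Fintype n] [DecidableEq n] in
/-- `y ∈ cube c R ⟹ l1 (y − c) ≤ d·R`. [folklore] -/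
theorem l1_sub_le_of_mem_cube {c y : Site d} {R : ℕ} (hy : y ∈ cube c R) : l1 (y - c) ≤ d * R := by
  unfold l1
  have h := mem_cube.mp hy
  calc ∑ κ : Fin d, ((y - c) κ).natAbs ≤ ∑ _κ : Fin d, R := Finset.sum_le_sum fun κ _ => by
          have hκ := h κ
          have : (((y - c) κ).natAbs : ℤ) ≤ R := by rw [Int.natCast_natAbs]; exact hκ
          exact_mod_cast this
    _ = d * R := by rw [Finset.sum_const, Finset.card_univ, Fintype.card_fin, smul_eq_mul]

omit [Fintype n] [DecidableEq n] in
/-- A `P`-periodic real function on `ℤ^d` takes at `y` its value at the reduction of `y` into the period box. [folklore] -/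
theorem periodic_eval_eq_boxVec {P : ℕ} [NeZero P] (g : Site d → ℝ) (hg : ∀ (y : Site d) (i : Fin d), g (y + (P : ℤ) • e i) = g y) (y : Site d) :
    g y = g (boxVec P (redN P y)) := by
  have h := periodic_smul_vec (f := g) hg (boxVec P (redN P y)) (fun i => y i / (P : ℤ))
  rw [← eq_wrap_add P y] at h
  exact h

/-! ## §2 (10) TYPE up to a logarithm for a tangent-critical configuration -/

set_option maxHeartbeats 800000 in
/-- **THE POINTWISE FLUX-GRADIENT LETTER OF A TANGENT-CRITICAL SMALL-FIELD CONFIGURATION, ANY DATUM, ANY SCALE `m ≥ 1`** (statement in the file header). [folklore] -/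
theorem fluxGrad_le_of_tanCritical [Nonempty n] (hd : 3 ≤ d) : ∃ C : ℝ, 0 ≤ C ∧
    ∀ {L : ℕ}, 2 ≤ L → ∀ (k : ℕ) {N : ℕ} [NeZero N] {U : Site d → Fin d → (Matrix n n ℂ)ˣ} {x a : ℝ},
    IsUnitaryCfg U → IsPeriodicCfg U ((N * L ^ (k + 1) : ℕ) : ℤ) → 0 ≤ x → LevelSmall d L k x → SmallField U x →
    cruxC d L * (((L : ℝ) ^ (k + 1)) ^ 2 * x) < 1 → thetaLoc d L * (((L : ℝ) ^ (k + 1)) ^ 2 * x) < 1 → ((L : ℝ) ^ (k + 1)) ^ 2 * x ≤ 1 →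
    0 ≤ a → a ≤ 1 / 50 → SmallField U a →
    (∀ Y' : Site d → Fin d → Matrix n n ℂ, IsSkewDir Y' → IsPeriodicDir Y' ((N * L ^ (k + 1) : ℕ) : ℤ) →
      dirIter L (k + 1) U Y' = 0 → dAction U Y' (perWin d (N * L ^ (k + 1))) = 0) →
    ∀ (m : ℕ), 1 ≤ m → ∀ (x₀ : Site d) (j μ ν : Fin d) (h : μ < ν),
      ‖covGrad U (flux U) x₀ j ⟨(μ, ν), h⟩‖
        ≤ C * ((1 + Real.log (m : ℝ))
              * (248 * a ^ 2 + 12 * ((((d + 1) * (d * (3 * m + 2)) : ℕ) : ℝ) * a) * a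
                + 2 * (Fintype.card n *
                    ((a * ((curl1C d L / (1 - thetaLoc d L * (((L : ℝ) ^ (k + 1)) ^ 2 * x))) * (((L : ℝ) ^ (k + 1)) ^ d / ((L : ℝ) ^ (k + 1)) ^ 2)))
                        * (Real.exp (((L : ℝ) ^ d / L) * ((d : ℝ) * (16 * ((d : ℝ) + 1) * ((d : ℝ) + 4) * (L : ℝ) ^ 2)
                            * (1250 * ((nbRad d L : ℝ) + L) + 8 * ((d : ℝ) * L) + 2 * L)) * (2 / twoLevelSmall d L))
                          * ((L : ℝ) / (L : ℝ) ^ d) ^ (k + 1))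
                      + 12 * (Fintype.card (T4AveragingDeficitWall.Plane d) : ℝ) * a ^ 2)
                  + 4 * d * ((((d + 1) * (d * (3 * m + 2)) : ℕ) : ℝ) * a) * a))
            + 2 * a / m)
          + 4 * ((((d + 1) * (d * (3 * m + 2)) : ℕ) : ℝ) * a) * a := by
  obtain ⟨C, hC, hletter⟩ := fluxGrad_interior_letter (d := d) (n := n) hd
  refine ⟨C, hC, ?_⟩
  intro L hL k N _ U x a hUu hUP hx hs hUx hθ hθl hε ha ha50 hUa hcrit m hm x₀ j μ ν hμν
  have ha4 : a ≤ 1 / 4 := ha50.trans (by norm_num)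
  -- the constants
  set τ : ℝ := ((((d + 1) * (d * (3 * m + 2)) : ℕ) : ℝ) * a) with hτ
  have hτ0 : 0 ≤ τ := by rw [hτ]; positivity
  set Tc : ℝ := Fintype.card n *
      ((a * ((curl1C d L / (1 - thetaLoc d L * (((L : ℝ) ^ (k + 1)) ^ 2 * x))) * (((L : ℝ) ^ (k + 1)) ^ d / ((L : ℝ) ^ (k + 1)) ^ 2)))
          * (Real.exp (((L : ℝ) ^ d / L) * ((d : ℝ) * (16 * ((d : ℝ) + 1) * ((d : ℝ) + 4) * (L : ℝ) ^ 2)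
              * (1250 * ((nbRad d L : ℝ) + L) + 8 * ((d : ℝ) * L) + 2 * L)) * (2 / twoLevelSmall d L))
            * ((L : ℝ) / (L : ℝ) ^ d) ^ (k + 1))
        + 12 * (Fintype.card (T4AveragingDeficitWall.Plane d) : ℝ) * a ^ 2) with hTc
  have hTc0 : 0 ≤ Tc := by
    rw [hTc]
    have hpos : 0 < 1 - thetaLoc d L * (((L : ℝ) ^ (k + 1)) ^ 2 * x) := by linarith
    have := curl1C_nonneg d L
    have : 0 ≤ twoLevelSmall d L := by unfold twoLevelSmall; positivity
    positivity
  -- (1) the near-identity gauge around `x₀`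
  obtain ⟨u, hu, hnear⟩ := exists_nearId_gauge hUu ha hUa x₀ (d * (3 * m + 2))
  have hVu : IsUnitaryCfg (gaugeAct u U) := isUnitaryCfg_gaugeAct hu hUu
  have hVa : SmallField (gaugeAct u U) a := smallField_gaugeAct hu hUa
  have hflat : ∀ y ∈ cube x₀ (3 * m + 2), ∀ κ : Fin d, ‖((gaugeAct u U y κ : (Matrix n n ℂ)ˣ) : Matrix n n ℂ) - 1‖ ≤ τ := by
    intro y hy κ
    rw [hτ]
    exact hnear y κ (l1_sub_le_of_mem_cube hy)
  -- (2) the flux forms and the tension bound on the cube (gauge covariance + periodicity + gen 91)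
  obtain ⟨B, hBF, hanti⟩ := exists_fluxForm U
  obtain ⟨B', hBF', hanti'⟩ := exists_fluxForm (gaugeAct u U)
  have hP : 1 ≤ N * L ^ (k + 1) := Nat.one_le_iff_ne_zero.mpr (Nat.mul_ne_zero (NeZero.ne N) (pow_ne_zero _ (by omega)))
  haveI : NeZero (N * L ^ (k + 1)) := ⟨by omega⟩
  have hTper : ∀ (ν' : Fin d) (z : Site d) (i : Fin d),
      ‖∑ μ' : Fin d, cDstar U μ' (fun w => B w μ' ν') (z + ((N * L ^ (k + 1) : ℕ) : ℤ) • e i)‖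
        = ‖∑ μ' : Fin d, cDstar U μ' (fun w => B w μ' ν') z‖ := by
    intro ν' z i
    congr 1
    refine Finset.sum_congr rfl fun μ' _ => ?_
    unfold cDstar
    dsimp only
    rw [add_sub_right_comm, fluxForm_periodic hUP hBF hanti, hUP (z - e μ') i μ', fluxForm_periodic hUP hBF hanti]
  have hT : ∀ z ∈ cube x₀ (3 * m + 1), ∀ ν' : Fin d, ‖∑ μ' : Fin d, cDstar (gaugeAct u U) μ' (fun w => B' w μ' ν') z‖ ≤ Tc := by
    intro z _ ν'
    rw [norm_tension_gaugeAct hu ha4 hUa hBF hanti hBF' hanti' z ν']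
    have hred := periodic_eval_eq_boxVec (P := N * L ^ (k + 1)) (fun z => ‖∑ μ' : Fin d, cDstar U μ' (fun w => B w μ' ν') z‖) (hTper ν') z
    rw [hred, hTc]
    exact norm_tension_le_of_tanCritical_gen hL k hUu hUP hx hs hUx hθ hθl hε ha ha4 hUa hcrit hBF hanti (boxVec_redN_mem _ z) ν'
  -- (3) the interior letter at `V = U^u`
  have hmain := hletter m hm (gaugeAct u U) hVu a τ Tc ha ha50 hVa hτ0 hTc0 B' hBF' hanti' x₀ hflat hT j μ ν hμν
  -- (4) back to `U` by gauge covariance of the flux gradient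
  have hlt : ∀ p : T4AveragingDeficitWall.Plaq d, ‖((fhol (gaugeAct u U) p : (Matrix n n ℂ)ˣ) : Matrix n n ℂ) - 1‖ < 1 := fun p =>
    (norm_fhol_sub_one_le_of_smallField hVa p).trans_lt (by linarith)
  rw [norm_covGrad_flux_eq_of_gaugeAct hu U x₀ j ⟨(μ, ν), hμν⟩ (hlt _) (hlt _)]
  rw [hτ, hTc] at hmain
  exact hmain

end

end Summit.QuantumFields.BalabanUV.T4Continuum.NE7FluxGradOfTanCritical
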